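import Literature.MathematicalPhysics.QuantumFieldTheory.Balaban1983to89.TorusGeometry
import Literature.MathematicalPhysics.QuantumFieldTheory.Balaban1983to89.MatrixNorms
import Literature.MathematicalPhysics.QuantumFieldTheory.Balaban1983to89.LatticeNorms

/-!
# `Balaban1983to89.B7SectAStatements` — T. Bałaban, *Averaging operations for lattice gauge theories*, Commun. Math. Phys.
**98** (1985) 17–51 [Balaban1985Averaging]: the blocks of order `j` (2)–(3) (Introduction, p. 17) and the literal matrix form of
the scalar product (18) (Sect. A, p. 21), typed CONCRETELY over the shared carriers

statement-level skeleton of published theorems with citation tags; proofs where landed; nothing here is a claim about the Yang–Mills mass gap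

PDF held: `paper:balaban1985-cmp98-averaging` (journal page = PDF page + 16).  Renders read as images by the typing seat:
`run/shared/lean/pub/pub-balaban/b2b-balaban-ref1/pages/1985-cmp98-averaging/1985-cmp98-averaging-p001-x2.png` (p. 17) and
`…-p005-x2.png` (p. 21).

CITATION HEADER (lean-in-tree rule).  This module is part of the lit-balaban TYPED SKELETON (HOME `run/shared/lean/pub/lit-balaban/`,
SKELETON.md rows `B7.Def3` = PHASE2-TARGETS.md §C and `B7.Eq18`).  PRINT, verbatim.  p. 17: "For a point `y ∈ L^n η Z^d` (or any
lattice `δZ^d`), we define a block of an order `j` as the cube `B^j(y) = {x ∈ L^{-j} L^n η Z^d : y_μ ≦ x_μ < y_μ + L^n η, μ = 1, …, d}` (2)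
(or the corresponding cube with `L^n η` replaced by `δ`). We will omit the subscript `j` if `j = 1`. For a subset `Λ ⊂ L^n η Z^d`
(or `⊂ δZ^d`), we define `B^j(Λ) = ⋃_{y ∈ Λ} B^j(y) ⊂ L^{-j} L^n η Z^d` (or `⊂ L^{-j} δ Z^d`). (3)"  p. 21: "and a scalar product in
spaces of matrix valued functions defined on subsets `Ω ⊂ ηZ^d`  `⟨X, Y⟩ = Σ_{x ∈ Ω} η^d tr X*(x) Y(x)`, (18) similarly for functions
defined at bonds or plaquettes of `Ω`. The scalar products define the corresponding norms. They are `L²` norms and are denoted by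
`‖·‖`, e.g., for a matrix `X` the norm is given by `‖X‖² = tr X*X`. The `L^p` norms, `1 ≦ p ≦ ∞`, are defined in an obvious way."

WHAT IS TYPED AND HOW.
* §1, (2)–(3) on the tori `T^{(i)}` of the shared vocabulary `…Balaban1983to89.Setup` (`Site P i`, one-level block map `blockOf`,
  block `block`; `TorusGeometry` for `Site.card_block`): the `j`-FOLD block map `blockOfIter j : Site P i → Site P (i + j)`
  (`x ↦` the unique `y` with `x ∈ B^j(y)`), the block of order `j` `blockJ j y` (2) and `blockJSet j Λ = B^j(Λ)` (3) as `Finset`s,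
  with the printed union form (3) PROVED (`blockJSet_eq_biUnion`), the nesting `B^{j+1}(z) = B^j(B(z))` (`blockJ_succ`), `B¹ = B`
  (`blockJ_one`), disjointness of distinct blocks, and the site count `|B^j(y)| = L^{dj}` in the standing range `i + j ≦ m + K`
  (`card_blockJ`).  Typed reading / DIVERGENCE (inherited, flagged): `Setup` indexes lattices by the number of coarsening steps from
  the finest torus (`i = 0` finest), so B7's `L^{-j} L^n η Z^d ⊃ L^n η Z^d` is `Site P i → Site P (i + j)`; `Setup`'s blocks are the
  CENTRED cubes of [Balaban1987RG1] (0.1)/(0.3) (`L` odd), whereas (2) anchors `B^j(y)` at its corner `y` (DIVERGENCE F3 of the audit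
  cell `pub-balaban`, documented at `Setup.blockOf`) — every statement below is insensitive to the anchor.  The one-level objects
  `blockOf`/`block` and the one-level set operation on the (Higgs)₂,₃ lattices (`HiggsLattice.blockSet`, [Balaban1982Higgs1] (1.18))
  already exist and are not restated; the `j`-fold objects did not (PHASE2-TARGETS.md §C `B7.Def3`).
* §2, (18) for MATRIX-valued functions, literally: `mInner w S X Y = Σ_{x ∈ S} w · tr X(x)* Y(x)` with B7's NORMALIZED trace
  `tr = MatrixNorms.ntr` ((17) p. 20, `tr 1 = 1`) — i.e. `Σ w · nhsInner (X x) (Y x)` — over any finite index set of cells (`S : Finset ι`,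
  `ι` = `Site P j` / `PBond P j` / `Plaq P j` for "sites, bonds or plaquettes of `Ω`") and an explicit real weight `w` (`w = η^d`
  = `LatticeNorms.volElt η d`; spacings are bookkeeping reals in `Setup`), the `L²` norm `mNorm` it defines (`mNormSq w S X
  = Σ w ‖X(x)‖²`, `‖X‖² = tr X*X` = `MatrixNorms.nhsNormSq`), `⟨X, X⟩ = ‖X‖²` and hermitian symmetry PROVED, and the comparison
  `‖X‖² ≦ η^d |Ω| (sup_x |X(x)|)²` with the OPERATOR norm (19) inside the sup (from (20) `‖X‖ ≦ |X|`, `MatrixNorms.nhsNorm_le_opNorm`).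
  ALREADY IN THE TREE and therefore not restated: (18) for functions with values in a REAL inner-product space together with the
  `L^p` norms of p. 21 (`LatticeNorms.l2Inner/l2NormSq/l2Norm/lpNormPow/lpNorm`, unit r19), the real scalar site/bond pairings
  (`LatticeFieldCalculus.sitePairing/bondPairing`, unit r18), the matrix norms (17), (19), (20) (`MatrixNorms`).  This section is the
  literal complex-matrix form the `𝔤`-valued fields of B7–B9 are written in (SKELETON row `B7.Eq18`, r18 register G04 "absent
  (𝔤-valued with tr)").
NOTHING of the paper is asserted beyond these definitions and their elementary API (finite sums; no analysis).  Unit `lit-balaban-r04`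
(gen 2), 2026-08-20; filed by the reader (HOME/FILED.md).
-/

open scoped BigOperators Matrix ComplexConjugate

namespace Literature.MathematicalPhysics.QuantumFieldTheory.Balaban1983to89

namespace B7SectAStatements

/-! ## 1. Blocks of order `j`: (2)–(3) p. 17 -/

section Blocks

variable {P : Params} {i : ℕ}

/-- **(2)** p. 17 [PDF 1], the `j`-fold block map: `blockOfIter j x` is the point `y` of the `j` times coarser lattice with
`x ∈ B^j(y)`, i.e. the `j`-th iterate of the one-level block map `blockOf` of `Setup` (B7: "We will omit the subscript `j` if
`j = 1`"). [cite: Balaban1985Averaging, (2) p.17] -/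
def blockOfIter : (j : ℕ) → Site P i → Site P (i + j)
  | 0, x => x
  | j + 1, x => blockOf (blockOfIter j x)

/-- `blockOfIter 0 = id`. [cite: Balaban1985Averaging, (2) p.17] -/
@[simp] theorem blockOfIter_zero (x : Site P i) : blockOfIter 0 x = x := rfl

/-- `blockOfIter (j+1) = blockOf ∘ blockOfIter j`. [cite: Balaban1985Averaging, (2) p.17] -/
@[simp] theorem blockOfIter_succ (j : ℕ) (x : Site P i) : blockOfIter (j + 1) x = blockOf (blockOfIter j x) := rfl

/-- **(2)** p. 17 [PDF 1], verbatim: *"we define a block of an order `j` as the cube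
`B^j(y) = {x ∈ L^{-j} L^n η Z^d : y_μ ≦ x_μ < y_μ + L^n η, μ = 1, …, d}`"* — typed reading: the set of sites `x` of `T^{(i)}`
(`j` levels finer than the lattice `T^{(i+j)}` of `y`) whose `j`-fold block point is `y`; centred-cube convention of `Setup`
(DIVERGENCE F3, see the module docstring). [cite: Balaban1985Averaging, (2) p.17] -/
def blockJ (j : ℕ) (y : Site P (i + j)) : Finset (Site P i) :=
  Finset.univ.filter fun x => blockOfIter j x = y

/-- **(3)** p. 17 [PDF 1], verbatim: *"For a subset `Λ ⊂ L^n η Z^d` (or `⊂ δZ^d`), we define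
`B^j(Λ) = ⋃_{y ∈ Λ} B^j(y) ⊂ L^{-j} L^n η Z^d`"* — typed as the finite set of sites whose `j`-fold block point lies in `Λ`
(equal to the printed union: `blockJSet_eq_biUnion`). [cite: Balaban1985Averaging, (3) p.17] -/
def blockJSet (j : ℕ) (Λ : Finset (Site P (i + j))) : Finset (Site P i) :=
  Finset.univ.filter fun x => blockOfIter j x ∈ Λ

/-- `x ∈ B^j(y) ↔` the `j`-fold block point of `x` is `y`. [cite: Balaban1985Averaging, (2) p.17] -/
@[simp] theorem mem_blockJ (j : ℕ) (y : Site P (i + j)) (x : Site P i) : x ∈ blockJ j y ↔ blockOfIter j x = y := by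
  simp [blockJ]

/-- `x ∈ B^j(Λ) ↔` the `j`-fold block point of `x` lies in `Λ`. [cite: Balaban1985Averaging, (3) p.17] -/
@[simp] theorem mem_blockJSet (j : ℕ) (Λ : Finset (Site P (i + j))) (x : Site P i) :
    x ∈ blockJSet j Λ ↔ blockOfIter j x ∈ Λ := by
  simp [blockJSet]

/-- **(3)** as printed: `B^j(Λ) = ⋃_{y ∈ Λ} B^j(y)`. [cite: Balaban1985Averaging, (3) p.17] -/
theorem blockJSet_eq_biUnion (j : ℕ) (Λ : Finset (Site P (i + j))) : blockJSet j Λ = Λ.biUnion (blockJ j) := by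
  ext x
  simp

/-- `B^j({y}) = B^j(y)`. [cite: Balaban1985Averaging, (3) p.17] -/
theorem blockJSet_singleton (j : ℕ) (y : Site P (i + j)) : blockJSet j {y} = blockJ j y := by
  ext x
  simp

/-- "We will omit the subscript `j` if `j = 1`": the block of order `1` is the one-level block `B(y)` of `Setup`.
[cite: Balaban1985Averaging, (2) p.17] -/
theorem blockJ_one (y : Site P (i + 1)) : blockJ 1 y = block y := by
  ext x
  simp [block]

/-- `B⁰(y) = {y}`. [cite: Balaban1985Averaging, (2) p.17] -/
theorem blockJ_zero (y : Site P (i + 0)) : blockJ 0 y = {y} := by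
  ext x
  simp [eq_comm]

/-- Nesting of blocks: `B^{j+1}(z) = B^j(B(z))` — the block of order `j+1` over `z` is the union of the blocks of order `j` over
the sites of the one-level block `B(z)`. [cite: Balaban1985Averaging, (3) p.17] -/
theorem blockJ_succ (j : ℕ) (z : Site P (i + j + 1)) : blockJ (j + 1) z = blockJSet j (block z) := by
  ext x
  simp [block]

/-- Distinct points have disjoint blocks of order `j`. [cite: Balaban1985Averaging, (2) p.17] -/
theorem disjoint_blockJ (j : ℕ) {y y' : Site P (i + j)} (h : y ≠ y') : Disjoint (blockJ j y) (blockJ j y') := by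
  rw [Finset.disjoint_left]
  intro x hx hx'
  rw [mem_blockJ] at hx hx'
  exact h (hx.symm.trans hx')

/-- The blocks of order `j` over ALL points cover the fine lattice: `B^j(T^{(i+j)}) = T^{(i)}`. [cite: Balaban1985Averaging, (3) p.17] -/
theorem blockJSet_univ (j : ℕ) : blockJSet (P := P) (i := i) j Finset.univ = Finset.univ := by
  ext x
  simp

/-- `B^j` is monotone in `Λ`. [cite: Balaban1985Averaging, (3) p.17] -/
theorem blockJSet_mono (j : ℕ) {Λ Λ' : Finset (Site P (i + j))} (h : Λ ⊆ Λ') : blockJSet j Λ ⊆ blockJSet j Λ' := by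
  intro x hx
  rw [mem_blockJSet] at hx ⊢
  exact h hx

/-- `|B^j(Λ)| = Σ_{y ∈ Λ} |B^j(y)|` (the union (3) is disjoint). [cite: Balaban1985Averaging, (3) p.17] -/
theorem card_blockJSet (j : ℕ) (Λ : Finset (Site P (i + j))) :
    (blockJSet j Λ).card = ∑ y ∈ Λ, (blockJ j y).card := by
  rw [blockJSet_eq_biUnion, Finset.card_biUnion]
  intro y _ y' _ h
  exact disjoint_blockJ j h

/-- `|B^j(y)| = L^{dj}`: a block of order `j` has exactly `(L^d)^j` sites of the fine lattice, in the standing range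
`i + j ≦ m + K` of `Setup` (from `Site.card_block`, `|B(y)| = L^d`). [cite: Balaban1985Averaging, (2) p.17] -/
theorem card_blockJ : ∀ (j : ℕ), i + j ≤ P.m + P.K → ∀ y : Site P (i + j), (blockJ j y).card = (P.L ^ P.d) ^ j
  | 0, _, y => by rw [blockJ_zero, Finset.card_singleton, pow_zero]
  | j + 1, hj, z => by
    have hj' : i + j ≤ P.m + P.K := by omega
    have hz : i + j + 1 ≤ P.m + P.K := by omega
    rw [blockJ_succ, card_blockJSet, Finset.sum_congr rfl fun y _ => card_blockJ j hj' y, Finset.sum_const,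
      Site.card_block hz, smul_eq_mul, pow_succ, mul_comm]

end Blocks

/-! ## 2. The scalar product (18) for matrix-valued lattice functions, literally (p. 21) -/

section Pairing

open MatrixNorms

variable {ι : Type*} {n : Type*} [Fintype n]

/-- **(18)** p. 21 [PDF 5], verbatim: *"a scalar product in spaces of matrix valued functions defined on subsets `Ω ⊂ ηZ^d`
`⟨X, Y⟩ = Σ_{x ∈ Ω} η^d tr X*(x) Y(x)`, similarly for functions defined at bonds or plaquettes of `Ω`"* — typed reading: `S = Ω`
a finite set of cells (sites / bonds / plaquettes: `ι` = `Site P j` / `PBond P j` / `Plaq P j`), weight `w = η^d`, `tr` = the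
NORMALIZED trace (17) (`MatrixNorms.ntr`, `tr 1 = 1`), so the summand is `w · nhsInner (X x) (Y x) = w · tr X(x)* Y(x)`.
[cite: Balaban1985Averaging, (18) p.21] -/
noncomputable def mInner (w : ℝ) (S : Finset ι) (X Y : ι → Matrix n n ℂ) : ℂ :=
  ∑ x ∈ S, (w : ℂ) * nhsInner (X x) (Y x)

/-- **(18)/p. 21**, verbatim: *"The scalar products define the corresponding norms. They are `L²` norms and are denoted by `‖·‖`,
e.g., for a matrix `X` the norm is given by `‖X‖² = tr X*X`"* — the square `‖X‖² = Σ_{x ∈ Ω} η^d ‖X(x)‖²` with the matrix `L²`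
norm `MatrixNorms.nhsNormSq` inside. [cite: Balaban1985Averaging, (18) p.21] -/
noncomputable def mNormSq (w : ℝ) (S : Finset ι) (X : ι → Matrix n n ℂ) : ℝ :=
  ∑ x ∈ S, w * nhsNormSq (X x)

/-- The `L²` norm `‖X‖ = ⟨X, X⟩^{1/2}` of a matrix-valued lattice function (p. 21). [cite: Balaban1985Averaging, (18) p.21] -/
noncomputable def mNorm (w : ℝ) (S : Finset ι) (X : ι → Matrix n n ℂ) : ℝ :=
  Real.sqrt (mNormSq w S X)

/-- `⟨X, X⟩ = ‖X‖²` ("The scalar products define the corresponding norms", p. 21). [cite: Balaban1985Averaging, (18) p.21] -/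
theorem mInner_self (w : ℝ) (S : Finset ι) (X : ι → Matrix n n ℂ) : mInner w S X X = (mNormSq w S X : ℂ) := by
  unfold mInner mNormSq
  rw [Complex.ofReal_sum]
  refine Finset.sum_congr rfl fun x _ => ?_
  rw [nhsInner_self, Complex.ofReal_mul]

/-- `‖X‖² = Σ_{x ∈ Ω} η^d ‖X(x)‖²` with the matrix `L²` norm `‖·‖ = MatrixNorms.nhsNorm` of p. 21 (so `mNormSq` is
`LatticeNorms.l2NormSq` computed with that matrix norm). [cite: Balaban1985Averaging, (18) p.21] -/
theorem mNormSq_eq_sum_nhsNorm_sq (w : ℝ) (S : Finset ι) (X : ι → Matrix n n ℂ) :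
    mNormSq w S X = ∑ x ∈ S, w * nhsNorm (X x) ^ 2 := by
  unfold mNormSq
  refine Finset.sum_congr rfl fun x _ => ?_
  rw [nhsNorm_sq]

/-- Hermitian symmetry of the matrix scalar product (17): `conj (tr X*Y) = tr Y*X`. [cite: Balaban1985Averaging, (17) p.20] -/
theorem conj_nhsInner (X Y : Matrix n n ℂ) : conj (nhsInner X Y) = nhsInner Y X := by
  unfold nhsInner ntr
  rw [map_div₀, map_natCast, starRingEnd_apply, ← Matrix.trace_conjTranspose, Matrix.conjTranspose_mul,
    Matrix.conjTranspose_conjTranspose]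

/-- Hermitian symmetry of (18): `conj ⟨X, Y⟩ = ⟨Y, X⟩` (real weight). [cite: Balaban1985Averaging, (18) p.21] -/
theorem conj_mInner (w : ℝ) (S : Finset ι) (X Y : ι → Matrix n n ℂ) : conj (mInner w S X Y) = mInner w S Y X := by
  unfold mInner
  rw [map_sum]
  refine Finset.sum_congr rfl fun x _ => ?_
  rw [map_mul, Complex.conj_ofReal, conj_nhsInner]

/-- (18) is additive in the second argument. [cite: Balaban1985Averaging, (18) p.21] -/
theorem mInner_add_right (w : ℝ) (S : Finset ι) (X Y Z : ι → Matrix n n ℂ) :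
    mInner w S X (Y + Z) = mInner w S X Y + mInner w S X Z := by
  unfold mInner
  rw [← Finset.sum_add_distrib]
  refine Finset.sum_congr rfl fun x _ => ?_
  simp only [Pi.add_apply, nhsInner, ntr, Matrix.trace_add, add_div, mul_add]

/-- (18) is `ℂ`-homogeneous in the second argument. [cite: Balaban1985Averaging, (18) p.21] -/
theorem mInner_smul_right (w : ℝ) (S : Finset ι) (c : ℂ) (X Y : ι → Matrix n n ℂ) :
    mInner w S X (c • Y) = c * mInner w S X Y := by
  unfold mInner
  rw [Finset.mul_sum]
  refine Finset.sum_congr rfl fun x _ => ?_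
  simp only [Pi.smul_apply, nhsInner, ntr, Matrix.mul_smul, Matrix.trace_smul, smul_eq_mul]
  ring

/-- `‖X‖² ≧ 0` for a nonnegative weight. [cite: Balaban1985Averaging, (18) p.21] -/
theorem mNormSq_nonneg {w : ℝ} (hw : 0 ≤ w) (S : Finset ι) (X : ι → Matrix n n ℂ) : 0 ≤ mNormSq w S X :=
  Finset.sum_nonneg fun x _ => mul_nonneg hw (nhsNormSq_nonneg (X x))

/-- `‖X‖ ≧ 0`. [cite: Balaban1985Averaging, (18) p.21] -/
theorem mNorm_nonneg (w : ℝ) (S : Finset ι) (X : ι → Matrix n n ℂ) : 0 ≤ mNorm w S X := Real.sqrt_nonneg _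

/-- `‖X‖² = (‖X‖)²` for a nonnegative weight. [cite: Balaban1985Averaging, (18) p.21] -/
theorem mNorm_sq {w : ℝ} (hw : 0 ≤ w) (S : Finset ι) (X : ι → Matrix n n ℂ) : mNorm w S X ^ 2 = mNormSq w S X :=
  Real.sq_sqrt (mNormSq_nonneg hw S X)

open scoped Matrix.Norms.L2Operator in
/-- `‖X‖² ≦ η^d |Ω| (sup_{x ∈ Ω} |X(x)|)²`: the `L²` norm (18) over a finite region is controlled by the sup of the OPERATOR norms
(19) — from (20) `‖X(x)‖ ≦ |X(x)|` (`MatrixNorms.nhsNorm_le_opNorm`); nonnegative weight; the sup is `LatticeNorms.supNorm` taken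
with the operator norm (19) on matrices. [cite: Balaban1985Averaging, (20) p.21] -/
theorem mNormSq_le_card_mul_supNorm_sq [DecidableEq n] {w : ℝ} (hw : 0 ≤ w) (S : Finset ι) (X : ι → Matrix n n ℂ) :
    mNormSq w S X ≤ w * S.card * LatticeNorms.supNorm S X ^ 2 := by
  unfold mNormSq
  calc ∑ x ∈ S, w * nhsNormSq (X x) ≤ ∑ x ∈ S, w * LatticeNorms.supNorm S X ^ 2 :=
        Finset.sum_le_sum fun x hx => mul_le_mul_of_nonneg_left
          ((nhsNormSq_le_opNorm_sq (X x)).trans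
            (pow_le_pow_left₀ (norm_nonneg _) (LatticeNorms.norm_le_supNorm X hx) 2)) hw
    _ = w * S.card * LatticeNorms.supNorm S X ^ 2 := by rw [Finset.sum_const, nsmul_eq_mul]; ring

end Pairing

end B7SectAStatements

end Literature.MathematicalPhysics.QuantumFieldTheory.Balaban1983to89
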